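import Summits.Ventures.CertifiedManyBodySolver.Certificates.HubbardSquare_n7o8_corr_rr166_rows234to236
import Summits.Ventures.CertifiedManyBodySolver.Rows.HalfFilledTLWords
import Summits.Ventures.CertifiedManyBodySolver.Rows.HalfFilledTLKinematic
import Literature.MathematicalPhysics.QuantumLattice.HubbardSpinMomentBounds
import Literature.MathematicalPhysics.QuantumLattice.HubbardNNNHoppingClusterEmbedding
import Literature.MathematicalPhysics.QuantumLattice.InfVolFermionStateBounds
import HarnessLib

/-!
# Nearest-neighbour singlet-bond density: the first two-sided DERIVED-CERTIFIED thermodynamic-limit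
# bond-pair cell at the M3′ point (`t′ = 0`)

HONEST FRAMING: first certified bounds; not a superconductivity verdict; every number certified or
labelled float.  Speedrun `mbsolver`, seat sr-mbsolver-m3-2 (pairing layer), gen 12, item (F).
Theorem-only; no definition, no named fact; zero compute.

The singlet-bond annihilator `s_{0y} = c_{0↑}c_{y↓} − c_{0↓}c_{y↑}` (`= √2·b_{0y}`,
`FermionSpinMoment.singletPair`) satisfies the singlet identity `s†s = ½ n_0 n_y − 2 𝐒_0·𝐒_y`
(`FermionSpinMoment.conjTranspose_singletPair_mul_self`).  Hence the LITERAL certificate objectives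
`densNN2 = ½ Σ_i n_0 n_{e_i}` (dictionary `densNN2_eq`, proved here) and `spinDotNN2 = ½ Σ_i 𝐒_0·𝐒_{e_i}`
(`M2.spinDotNNAvg2_eq`) combine into the BOND-SINGLET WORD
`W := densNN2 − 4·spinDotNN2 = Σ_{i=1,2} s_{0e_i}† s_{0e_i} = 2 Σ_i b_{0e_i}† b_{0e_i}` (`bondSingletWord_eq`),
i.e. `W/4` = the nearest-neighbour singlet-bond density per bond (= minus the `t–J` superexchange energy
per bond in units of `J`).  `W` is a sum of `A†A`'s, so `Re ω̄(W) ≥ 0` for EVERY state (KINEMATIC orbit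
lower row `m3_bondSinglet_orbit_lower_kinematic`, every `t′`, window, label set).
Orbit-mean rows are LINEAR in the word (`M3CorrOrbitLowerRow.add`, `.smul_nonneg`, proved here), so the
LANDED claim nodes of the CERTIFIED rows #235 (`dens_nn`, two-sided) and #234 (`spin_nn`, two-sided) at
the window `u₁₆₆ = -47814009469263/2^46` (`t′ = 0`) give the DERIVED-CERTIFIED two-sided cell on the
`D₄`-orbit mean `(1/8)Σ_g Re ω(g·W)`:
`[27365594267759966924332823/2^86 ≈ 0.3536855, 9428049157942279701674197/2^82 ≈ 1.9496757]`
(`m3_bondSinglet_tp0_orbit_lower_of_r234_r235`, `m3_bondSinglet_tp0_orbit_upper_of_r234_r235`,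
UNCONDITIONAL SHAPE with the e₀ upper #166: `m3_bondSinglet_tp0_uncond_of`), i.e. per-bond singlet
density `W/4 ∈ [0.0884214, 0.4874190]`.
HONEST LABEL: a linear combination of two certified rows, informative on both sides against the a-priori
scale `W/4 ∈ [0, 1]` (`0` = kinematic floor, proved; `1` = the two-site operator norm of `b†b`, NOT
formalised here — labelled), `2.5×` narrower; it certifies neither a sign of a connected correlator nor any
pairing statement — the bond singlet is the building block of the `d`-wave pair field `P_x = Σ_e g_e b_{x,e}`,
nothing more.  `t′ = −1/4`: no certified NN rows exist, nothing is derived.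

References: Bratteli–Robinson I (2nd ed.) §2.3.3 (positivity); Essler et al. (2005) §2.2.5;
Altland–Simons (2010) §2.2 (exchange interaction / singlet identity); Wang et al., PRX 14 (2024) 031006 §III.
-/

noncomputable section

namespace Summit.Ventures.CertifiedManyBodySolver

open Matrix Literature.MathematicalPhysics.QuantumLattice Literature.Probability.LatticeModels
open Literature.MathematicalPhysics.QuantumLattice.HubbardWave0
open ThermodynamicLimit Filter Topology
open Summit.HubbardSuperconductivity.ManyBodyBootstrap.Bounds
open scoped BigOperators ComplexOrder

/-! ## §1 Orbit-mean rows are linear in the word -/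

section OrbitAlgebra

variable {tp : ℝ} {u : ℚ} {S : Finset (DihedralGroup 4)} {Λ : Finset (Site 2)}

/-- **Additivity of orbit-mean lower rows**: rows `q₁` on `X` and `q₂` on `Y` give `q₁ + q₂` on `X + Y`
(linearity of `fermionEmbed` and `ω.expect`). [cite: BratteliRobinsonI1987, §2.3.3] -/
theorem M3CorrOrbitLowerRow.add {q₁ q₂ : ℚ} {X Y : FermionOp Λ} (h₁ : M3CorrOrbitLowerRow tp u q₁ S Λ X)
    (h₂ : M3CorrOrbitLowerRow tp u q₂ S Λ Y) : M3CorrOrbitLowerRow tp u (q₁ + q₂) S Λ (X + Y) := by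
  intro ω Ls ψ hLs hψ hψ1 hω hu
  have a := h₁ ω Ls ψ hLs hψ hψ1 hω hu
  have b := h₂ ω Ls ψ hLs hψ hψ1 hω hu
  simp only [map_add, Complex.add_re, Finset.sum_add_distrib, mul_add]
  push_cast
  linarith

/-- **Nonnegative scaling of orbit-mean lower rows**: a row `q` on `X` gives `a·q` on `a·X` for `0 ≤ a`.
[cite: BratteliRobinsonI1987, §2.3.3] -/
theorem M3CorrOrbitLowerRow.smul_nonneg {q a : ℚ} {X : FermionOp Λ} (h : M3CorrOrbitLowerRow tp u q S Λ X)
    (ha : 0 ≤ a) : M3CorrOrbitLowerRow tp u (a * q) S Λ (((a : ℚ) : ℂ) • X) := by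
  intro ω Ls ψ hLs hψ hψ1 hω hu
  have b := h ω Ls ψ hLs hψ hψ1 hω hu
  have key : ∀ g ∈ S, (ω.expect (d4ShiftSet g 0 Λ) (fermionEmbed (PolySite.d4Emb g 0 Λ) (((a : ℚ) : ℂ) • X))).re
      = (a : ℝ) * (ω.expect (d4ShiftSet g 0 Λ) (fermionEmbed (PolySite.d4Emb g 0 Λ) X)).re := by
    intro g _
    rw [map_smul, map_smul, smul_eq_mul, ← Complex.ofReal_ratCast, Complex.re_ofReal_mul]
  rw [Finset.sum_congr rfl key, ← Finset.mul_sum, mul_left_comm]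
  push_cast
  exact mul_le_mul_of_nonneg_left b (by exact_mod_cast ha)

/-- **State positivity on orbit means**: a word that is a finite sum of `Aᴴ A`'s has every orbit-mean
lower row `0` (no Hamiltonian input). [cite: BratteliRobinsonI1987, §2.3.3] -/
theorem M3CorrOrbitLowerRow.zero_of_posSemidef {X : FermionOp Λ} (hX : X.PosSemidef) :
    M3CorrOrbitLowerRow tp u 0 S Λ X := by
  intro ω Ls ψ hLs hψ hψ1 hω hu
  push_cast
  refine mul_nonneg (inv_nonneg.2 (Nat.cast_nonneg _)) (Finset.sum_nonneg fun g _ => ?_)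
  exact ω.expect_re_nonneg_of_posSemidef _ (posSemidef_fermionEmbed _ hX)

end OrbitAlgebra

/-! ## §2 The words: `densNN2` dictionary and the bond-singlet identity -/

namespace BondSingletTL

open Summit.Ventures.CertifiedManyBodySolver.Certificates

/-- `0 ≠ e₂` in `ℤ²` (the `e₁` companion is `M2.zero_ne_unitVec_zero`). [folklore] -/
theorem zero_ne_e2 : (0 : Site 2) ≠ unitVec 1 := fun h => by simpa using congr_fun h 1

/-- Distinct sites give distinct region points. [folklore] -/
theorem pt_ne_pt {Λ : Finset (Site 2)} {x y : Site 2} (hxy : x ≠ y) (hx : x ∈ Λ) (hy : y ∈ Λ) :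
    PolySite.pt x hx ≠ PolySite.pt y hy := fun h =>
  hxy (by simpa [PolySite.pt] using congrArg (fun z : PolySite Λ => ofLex z.1) h)

/-- Distinct sites give distinct orbitals. [folklore] -/
theorem orb_pt_ne {Λ : Finset (Site 2)} {x y : Site 2} (hxy : x ≠ y) (hx : x ∈ Λ) (hy : y ∈ Λ)
    (σ τ : Fin 2) : orb (PolySite.pt x hx) σ ≠ orb (PolySite.pt y hy) τ := fun h =>
  pt_ne_pt hxy hx hy (orb_eq_orb_iff.1 h).1

/-- **Normal order of a density–density word**: `n_{xσ} n_{yτ} = c†_{xσ} c†_{yτ} c_{yτ} c_{xσ}` for `x ≠ y`.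
[cite: EsslerEtAl2005, §2.1 eq. (2.2)] -/
theorem nAt_mul_nAt_eq_word {Λ : Finset (Site 2)} {x y : Site 2} (hxy : x ≠ y) (hx : x ∈ Λ) (hy : y ∈ Λ)
    (σ τ : Fin 2) :
    (nAt x hx σ * nAt y hy τ : FermionOp Λ) = (cAt x hx σ)ᴴ * (cAt y hy τ)ᴴ * cAt y hy τ * cAt x hx σ := by
  simp only [nAt, cAt, numberOp, annihilation_conjTranspose]
  exact creation_annihilation_mul_creation_annihilation_of_ne (orb_pt_ne hxy hx hy σ τ)

/-- **Dictionary for the literal `dens_nn` objective**: `densNN2 = ½ Σ_{i=1,2} n_0 n_{e_i}`,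
`n_x = n_{x↑} + n_{x↓}` (the 8 normal-ordered words ARE the bond-averaged density–density observable).
[cite: EsslerEtAl2005, §2.1 eq. (2.2)] -/
theorem densNN2_eq : densNN2 = (1 / 2 : ℂ) •
    ((nAt 0 zero_mem_nnSupport 0 + nAt 0 zero_mem_nnSupport 1) *
        (nAt (unitVec 0) e1_mem_nnSupport 0 + nAt (unitVec 0) e1_mem_nnSupport 1) +
      (nAt 0 zero_mem_nnSupport 0 + nAt 0 zero_mem_nnSupport 1) *
        (nAt (unitVec 1) e2_mem_nnSupport 0 + nAt (unitVec 1) e2_mem_nnSupport 1)) := by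
  simp only [add_mul, mul_add, nAt_mul_nAt_eq_word M2.zero_ne_unitVec_zero, nAt_mul_nAt_eq_word zero_ne_e2]
  unfold densNN2
  simp only [cNN]
  push_cast
  module

/-- **The bond-singlet word**: `densNN2 − 4·spinDotNN2 = Σ_{i=1,2} s_{0e_i}† s_{0e_i}` with
`s_{0y} = c_{0↑}c_{y↓} − c_{0↓}c_{y↑}` (`= √2 b_{0y}`), by the singlet identity `s†s = ½ n_0 n_y − 2 𝐒_0·𝐒_y`.
[cite: AltlandSimons2010, §2.2 (exchange interaction)] -/
theorem bondSingletWord_eq : densNN2 - (4 : ℂ) • spinDotNN2 =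
    (FermionSpinMoment.singletPair (PolySite.pt (0 : Site 2) zero_mem_nnSupport)
        (PolySite.pt (unitVec 0) e1_mem_nnSupport))ᴴ *
      FermionSpinMoment.singletPair (PolySite.pt (0 : Site 2) zero_mem_nnSupport)
        (PolySite.pt (unitVec 0) e1_mem_nnSupport) +
    (FermionSpinMoment.singletPair (PolySite.pt (0 : Site 2) zero_mem_nnSupport)
        (PolySite.pt (unitVec 1) e2_mem_nnSupport))ᴴ *
      FermionSpinMoment.singletPair (PolySite.pt (0 : Site 2) zero_mem_nnSupport)
        (PolySite.pt (unitVec 1) e2_mem_nnSupport) := by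
  rw [FermionSpinMoment.conjTranspose_singletPair_mul_self (pt_ne_pt M2.zero_ne_unitVec_zero _ _),
    FermionSpinMoment.conjTranspose_singletPair_mul_self (pt_ne_pt zero_ne_e2 _ _), densNN2_eq,
    show spinDotNN2 = M2.spinNNAvgObs from M2.spinDotNNAvg2_eq, M2.spinNNAvgObs]
  simp only [spinDotAt, nAt]
  module

/-- **The bond-singlet word is a sum of `A†A`'s, hence positive semidefinite.**
[cite: BratteliRobinsonI1987, §2.3.3] -/
theorem posSemidef_bondSingletWord : (densNN2 - (4 : ℂ) • spinDotNN2).PosSemidef := by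
  rw [bondSingletWord_eq]
  exact (posSemidef_conjTranspose_mul_self _).add (posSemidef_conjTranspose_mul_self _)

/-- `spinDotNN2Neg = −spinDotNN2` (coefficientwise). [cite: EsslerEtAl2005, §2.2.5 eq. (2.66)] -/
theorem spinDotNN2Neg_eq_neg : spinDotNN2Neg = -spinDotNN2 :=
  M2.spinDotNNAvg2Neg_eq

/-- The UPPER-side word: `densNN2Neg + 4·spinDotNN2 = −(densNN2 − 4·spinDotNN2)`. [folklore] -/
theorem densNN2Neg_add_eq_neg : densNN2Neg + (4 : ℂ) • spinDotNN2 = -(densNN2 - (4 : ℂ) • spinDotNN2) := by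
  rw [densNN2Neg_eq]; abel

/-- The LOWER-side word: `densNN2 + 4·spinDotNN2Neg = densNN2 − 4·spinDotNN2`. [folklore] -/
theorem densNN2_add_eq : densNN2 + (4 : ℂ) • spinDotNN2Neg = densNN2 - (4 : ℂ) • spinDotNN2 := by
  rw [spinDotNN2Neg_eq_neg, smul_neg, sub_eq_add_neg]

end BondSingletTL

/-! ## §3 Rows at the M3′ point -/

section M3

open BondSingletTL Summit.Ventures.CertifiedManyBodySolver.Certificates

/-- **KINEMATIC orbit lower row** (every `t′`, window, label set): `(1/|S|)Σ_{g∈S} Re ω(g·(densNN2 − 4·spinDotNN2)) ≥ 0`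
— the singlet-bond density is nonnegative in every state. [cite: BratteliRobinsonI1987, §2.3.3] -/
theorem m3_bondSinglet_orbit_lower_kinematic (tp : ℝ) (u : ℚ) (S : Finset (DihedralGroup 4)) :
    M3CorrOrbitLowerRow tp u 0 S nnSupport (densNN2 - (4 : ℂ) • spinDotNN2) :=
  M3CorrOrbitLowerRow.zero_of_posSemidef posSemidef_bondSingletWord

/-- **Generic derived LOWER row**: a `dens_nn` lower row `dlo` (on `densNN2`) and a `spin_nn` upper row typed as
a lower row `sq` on `spinDotNN2Neg` give `dlo + 4·sq` on the bond-singlet word.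
[cite: BratteliRobinsonI1987, §2.3.3] -/
theorem m3_bondSinglet_orbit_lower_of_rows {tp : ℝ} {u dlo sq : ℚ} {S : Finset (DihedralGroup 4)}
    (hd : M3CorrOrbitLowerRow tp u dlo S nnSupport densNN2)
    (hs : M3CorrOrbitLowerRow tp u sq S nnSupport spinDotNN2Neg) :
    M3CorrOrbitLowerRow tp u (dlo + 4 * sq) S nnSupport (densNN2 - (4 : ℂ) • spinDotNN2) := by
  have h := hd.add (hs.smul_nonneg (a := 4) (by norm_num))
  rwa [show (((4 : ℚ) : ℚ) : ℂ) = (4 : ℂ) by norm_num, densNN2_add_eq] at h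

/-- **Generic derived UPPER row** (typed as a lower row on the negated word): a `dens_nn` upper row typed as a
lower row `dq` on `densNN2Neg` and a `spin_nn` lower row `slo` on `spinDotNN2` give `dq + 4·slo` on
`−(densNN2 − 4·spinDotNN2)`, i.e. the orbit mean of the bond-singlet word is `≤ −(dq + 4·slo)`.
[cite: BratteliRobinsonI1987, §2.3.3] -/
theorem m3_bondSinglet_orbit_negUpper_of_rows {tp : ℝ} {u dq slo : ℚ} {S : Finset (DihedralGroup 4)}
    (hd : M3CorrOrbitLowerRow tp u dq S nnSupport densNN2Neg)
    (hs : M3CorrOrbitLowerRow tp u slo S nnSupport spinDotNN2) :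
    M3CorrOrbitLowerRow tp u (dq + 4 * slo) S nnSupport (-(densNN2 - (4 : ℂ) • spinDotNN2)) := by
  have h := hd.add (hs.smul_nonneg (a := 4) (by norm_num))
  rwa [show (((4 : ℚ) : ℚ) : ℂ) = (4 : ℂ) by norm_num, densNN2Neg_add_eq_neg] at h

/-! ### `t′ = 0`: the certified rows #235 (`dens_nn`) and #234 (`spin_nn`) at the window `u₁₆₆` -/

/-- **`t′ = 0`, DERIVED-CERTIFIED LOWER edge, HYPOTHESES = LANDED CLAIM NODES OF CERTIFIED ROWS** (#235 lower,
#234 upper; window = the certified e₀ upper of #166): the `D₄`-orbit mean of `Re ω(densNN2 − 4·spinDotNN2)` is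
`≥ 27365594267759966924332823/2^86 ≈ 0.3536855` (per-bond singlet density `≥ 0.0884214`).
[cite: WangEtAl2024, §III] -/
theorem m3_bondSinglet_tp0_orbit_lower_of_r234_r235 (hd : cert_r235_hubSQ_w3_U8_n7o8_R2b4eom_ob5p2_DNlo_rr166)
    (hs : cert_r234_hubSQ_w3_U8_n7o8_R2b4eom_ob5p2_Sup_rr166) :
    M3CorrOrbitLowerRow 0 (-47814009469263 / 70368744177664) (27365594267759966924332823 / 77371252455336267181195264)
      Finset.univ nnSupport (densNN2 - (4 : ℂ) • spinDotNN2) := by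
  have h := m3_bondSinglet_orbit_lower_of_rows hd hs
  convert h using 2; all_goals norm_num

/-- **`t′ = 0`, DERIVED-CERTIFIED UPPER edge** (#235 upper, #234 lower), typed as a lower row on the negated word:
orbit mean of `Re ω(−(densNN2 − 4·spinDotNN2)) ≥ −9428049157942279701674197/2^82`, i.e. the orbit mean of the
bond-singlet word is `≤ 9428049157942279701674197/2^82 ≈ 1.9496757` (per bond `≤ 0.4874190`).
[cite: WangEtAl2024, §III] -/
theorem m3_bondSinglet_tp0_orbit_upper_of_r234_r235 (hd : cert_r235_hubSQ_w3_U8_n7o8_R2b4eom_ob5p2_DNup_rr166)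
    (hs : cert_r234_hubSQ_w3_U8_n7o8_R2b4eom_ob5p2_Slo_rr166) :
    M3CorrOrbitLowerRow 0 (-47814009469263 / 70368744177664) (-9428049157942279701674197 / 4835703278458516698824704)
      Finset.univ nnSupport (-(densNN2 - (4 : ℂ) • spinDotNN2)) := by
  have h := m3_bondSinglet_orbit_negUpper_of_rows hd hs
  convert h using 2; all_goals norm_num

/-- Width of the derived `t′ = 0` cell on the word: `9428049157942279701674197/2^82 − 27365594267759966924332823/2^86
= 123483192259316508302454329/2^86 ≈ 1.5959903` (per bond `≈ 0.3989976`); a-priori scale of the word `[0, 4]`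
(`0` proved above; `4` = operator norm, labelled, not formalised). [cite: WangEtAl2024, §III] -/
theorem bondSinglet_tp0_width_eq :
    (9428049157942279701674197 / 4835703278458516698824704 : ℚ) - 27365594267759966924332823 / 77371252455336267181195264
      = 123483192259316508302454329 / 77371252455336267181195264 := by norm_num

/-- The derived lower edge is STRICTLY above the kinematic floor `0` and the derived upper edge is STRICTLY below the
labelled a-priori ceiling `4` of the word (both sides informative in the R-M3-22 sense). [cite: WangEtAl2024, §III] -/
theorem bondSinglet_tp0_edges_inside :
    (0 : ℚ) < 27365594267759966924332823 / 77371252455336267181195264 ∧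
      (9428049157942279701674197 / 4835703278458516698824704 : ℚ) < 4 := by
  constructor <;> norm_num

/-- **`t′ = 0`, UNCONDITIONAL SHAPE, ALL HYPOTHESES LANDED CLAIM NODES** (#235 two-sided, #234 two-sided, e₀ upper
#166 = the window literal): for EVERY torus limit of unit `(rectN (7/8) L, S^z = 0)`-sector ground states of
`hubbardTorusTT' L 1 0 8`, the `D₄`-orbit mean of `Re ω(g·(densNN2 − 4·spinDotNN2))` lies in
`[27365594267759966924332823/2^86, 9428049157942279701674197/2^82]`. [cite: WangEtAl2024, §III] -/
theorem m3_bondSinglet_tp0_uncond_of (hdlo : cert_r235_hubSQ_w3_U8_n7o8_R2b4eom_ob5p2_DNlo_rr166)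
    (hdup : cert_r235_hubSQ_w3_U8_n7o8_R2b4eom_ob5p2_DNup_rr166)
    (hslo : cert_r234_hubSQ_w3_U8_n7o8_R2b4eom_ob5p2_Slo_rr166)
    (hsup : cert_r234_hubSQ_w3_U8_n7o8_R2b4eom_ob5p2_Sup_rr166)
    (hE : cert_r166_openbox_32x4_U8_N112_tp0_D1000_b2) :
    ∀ (ω : InfVolFermionState 2) (Ls : ℕ → ℕ) (ψ : ∀ L, Fock (Orb (FermionTorus 2 L))),
      Tendsto Ls atTop atTop →
      (∀ j, IsGroundStateInSector (hubbardTorusTT' (Ls j) 1 0 8) (rectN (7 / 8) (Ls j)) 0 (ψ (Ls j))) →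
      (∀ j, star (ψ (Ls j)) ⬝ᵥ ψ (Ls j) = 1) → ω.IsTorusLimitOf ψ Ls →
      (27365594267759966924332823 / 77371252455336267181195264 : ℝ) ≤
          ((Finset.univ : Finset (DihedralGroup 4)).card : ℝ)⁻¹ *
            ∑ g ∈ (Finset.univ : Finset (DihedralGroup 4)),
              (ω.expect (d4ShiftSet g 0 nnSupport)
                (fermionEmbed (PolySite.d4Emb g 0 nnSupport) (densNN2 - (4 : ℂ) • spinDotNN2))).re ∧
        ((Finset.univ : Finset (DihedralGroup 4)).card : ℝ)⁻¹ *
            ∑ g ∈ (Finset.univ : Finset (DihedralGroup 4)),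
              (ω.expect (d4ShiftSet g 0 nnSupport)
                (fermionEmbed (PolySite.d4Emb g 0 nnSupport) (densNN2 - (4 : ℂ) • spinDotNN2))).re ≤
          9428049157942279701674197 / 4835703278458516698824704 := by
  intro ω Ls ψ h1 h2 h3 h4
  have hu : energyDensityTT' 1 0 8 (7 / 8) ≤ (((-47814009469263 / 70368744177664 : ℚ)) : ℝ) :=
    m3_tp0_upper_r166_of hE
  have hlo := m3_bondSinglet_tp0_orbit_lower_of_r234_r235 hdlo hsup ω Ls ψ h1 h2 h3 h4 hu
  have hup := m3_bondSinglet_tp0_orbit_upper_of_r234_r235 hdup hslo ω Ls ψ h1 h2 h3 h4 hu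
  simp only [map_neg, Complex.neg_re, Finset.sum_neg_distrib, mul_neg] at hup
  push_cast at hlo hup
  exact ⟨hlo, by linarith⟩

end M3

end Summit.Ventures.CertifiedManyBodySolver

end
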